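import Literature.MathematicalPhysics.QuantumFieldTheory.PolymerActivityAlgebra
import Mathlib.Algebra.BigOperators.Ring.Finset
import Mathlib.Algebra.Algebra.Subalgebra.Basic
import Mathlib.Analysis.Normed.Field.Basic
import HarnessLib

/-!
# Reblocking of polymer activities: the algebraic core of a single renormalisation-group step

Fix a finite set `Λ` of *fine* blocks (scale `j`), a set `Λ'` of *coarse* blocks (scale `j+1`)
and an arbitrary blocking map `π : Λ → Λ'` ("the coarse block containing `B`"; no `L`-adic or
surjectivity assumption, so irregular blockings of a torus of arbitrary side are covered). For a
fine polymer `X ⊆ Λ` its **closure** is `X̄ = π(X)` (the coarse blocks it meets, Brydges–Slade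
Def. 1.5.2) and for a coarse polymer `U ⊆ Λ'` its **refinement** is `π⁻¹(U)` (`refinement π U`).
Activities take values in a commutative ring `A` (in applications an algebra of functionals of the
field); `F^X = ∏_{B ∈ X} F(B)` is the block-factorised activity of `F : Λ → A` (`blockProd F`) and
`∘` is the circle product of `PolymerActivityAlgebra` (the multiplication of `PolymerActivity Λ A`).

* `blockProd_add` — **the binomial lemma** `(F₁ + F₂)^X = (F₁^• ∘ F₂^•)(X)`
  (Brydges–Slade V, Lemma 1.5.1).
* `reblock π F K`, `reblock_mul_blockProd_coarsen` — **the reblocking identity**: for every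
  activity `K` on fine polymers and every `F : Λ → A`,

    `(K ∘ F^•)(π⁻¹V) = (reblock π F K ∘ F̃^•)(V)`   for all coarse polymers `V`,

  where `F̃(B') = ∏_{π B = B'} F(B)` (`coarsen π F`) and
  `reblock π F K (U) = ∑_{X ⊆ π⁻¹U, X̄ = U} F^{π⁻¹U ∖ X} K(X)`.
  With `F = Ĩ` (the next-scale interaction, free of fluctuation fields) and `K` replaced by
  `δI^• ∘ θK`, `δI = θI − Ĩ`, this is the identity behind Brydges–Slade V Prop. 1.5.3 and
  Prop. 5.1.1 (`𝔼₊θ(Î ∘ K)(Λ) = (Ĩ ∘ K⁽³⁾)(Λ)`,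
  `K⁽³⁾(U) = ∑_{X̄ = U} Ĩ^{U∖X} 𝔼₊(δI ∘ θK)(X)`) *before* the expectation is taken; the version
  after a conditional expectation is `rgStep_spec` below.
* `reblock_union` — **component factorisation** at the algebraic level: if `K` factorises across
  the refinements of two disjoint coarse polymers `U₁, U₂`, then
  `reblock π F K (U₁ ∪ U₂) = reblock π F K U₁ · reblock π F K U₂`; `mul_apply_union` shows that the
  circle product preserves such factorisation (so `δI^• ∘ K` factorises when `K` does).
* `rgStep E π Ĩ δI K (U) = E (reblock π Ĩ (δI^• ∘ K) U)` for an `S`-linear map `E : A → S`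
  (a conditional expectation integrating out the fluctuation field: `S` = functionals of the
  coarse field, `A` an `S`-algebra of functionals of coarse and fluctuation fields) —
  `rgStep_spec`: `E((K ∘ (Ĩ + δI)^•)(π⁻¹V)) = (rgStep ∘ Ĩ̃^•)(V)` (Brydges–Slade V Prop. 5.1.1 with
  the field-independence of `Ĩ` made explicit as `S`-linearity), and `rgStep_union`: if `E` is
  multiplicative across two subalgebras `S₁, S₂ ⊆ A` (independence of the fluctuation field over
  the two regions — the finite-range property (1.40)/`Efaczz` of Brydges–Slade) which contain the
  data over `π⁻¹U₁`, `π⁻¹U₂` respectively, then `rgStep (U₁ ∪ U₂) = rgStep U₁ · rgStep U₂`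
  (the component factorisation of `K⁽³⁾`, Brydges–Slade V Prop. 5.1.1, second part).
* `norm_reblock_le` — the termwise norm bound
  `‖reblock π F K (U)‖ ≤ ∑_{X̄ = U} (∏_{B ∈ π⁻¹U∖X} ‖F B‖) ‖K X‖`.

Everything here is finite algebra (no analysis); the analytic content of a renormalisation-group
step (norms of `𝔼₊`, perturbative cancellations, large-set entropy — cf.
`CoarseGrainingLargeSets`, `CoarseGrainingEntropy`, `TphiSeminorm*`) is elsewhere.

## References

* D. C. Brydges, G. Slade, *A renormalisation group method. V. A single renormalisation group
  step*, J. Stat. Phys. 159 (2015) 589–667, §1.4 (Def. 1.4.1 circle product), §1.5 (Lemma 1.5.1,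
  Def. 1.5.2, Prop. 1.5.3), §5.1 (Prop. 5.1.1). arXiv:1403.7256. [BrydgesSlade2015RGV]
* D. C. Brydges, *Lectures on the renormalisation group*, IAS/Park City Math. Ser. 16, AMS 2009,
  §3.1, §5. [Brydges2009LecturesRG]
-/

noncomputable section

namespace Literature.MathematicalPhysics.QuantumFieldTheory

open Finset

namespace PolymerActivity

variable {Λ : Type*} {A : Type*} [CommRing A]

section BlockProd

/-! ### Block-factorised activities and the binomial lemma -/

/-- The **block-factorised activity** `F^X = ∏_{B ∈ X} F(B)` of a function `F` on blocks
("the appearance of the set `X` as an exponent signals functions that factorise over blocks").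
[cite: BrydgesSlade2015RGV, §1.6 eq. (1.31) (B-extension)] -/
def blockProd (F : Λ → A) : PolymerActivity Λ A := fun X => ∏ B ∈ X, F B

/-- Unfolding `blockProd`. [folklore] -/
@[simp] theorem blockProd_apply (F : Λ → A) (X : Finset Λ) : blockProd F X = ∏ B ∈ X, F B := rfl

/-- `F^∅ = 1`. [folklore] -/
theorem blockProd_empty (F : Λ → A) : blockProd F ∅ = 1 := by simp

/-- A ring homomorphism passes through block products: `f(F^X) = (f ∘ F)^X`. [folklore] -/
theorem map_blockProd {A' : Type*} [CommRing A'] (f : A →+* A') (F : Λ → A) (X : Finset Λ) :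
    f (blockProd F X) = blockProd (fun B => f (F B)) X := by
  simp only [blockProd_apply, map_prod]

variable [DecidableEq Λ]

/-- `F^{X ∪ Y} = F^X F^Y` for disjoint `X, Y`. [folklore] -/
theorem blockProd_union (F : Λ → A) {X Y : Finset Λ} (h : Disjoint X Y) :
    blockProd F (X ∪ Y) = blockProd F X * blockProd F Y := by
  simp only [blockProd_apply, prod_union h]

/-- **The binomial lemma** (Brydges–Slade V, Lemma 1.5.1): `(F₁ + F₂)^X = (F₁^• ∘ F₂^•)(X)`, i.e.
expanding the product `∏_{B ∈ X}(F₁(B) + F₂(B))` gives the circle product of the two block-factorised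
activities. [cite: BrydgesSlade2015RGV, Lemma 1.5.1] -/
theorem blockProd_add (F₁ F₂ : Λ → A) : blockProd (F₁ + F₂) = blockProd F₁ * blockProd F₂ := by
  ext X
  rw [mul_apply, blockProd_apply]
  simp only [Pi.add_apply, blockProd_apply]
  exact prod_add _ _ _

/-- The binomial lemma, pointwise form: `∏_{B ∈ X}(F₁ B + F₂ B) = ∑_{Y ⊆ X} F₁^Y F₂^{X∖Y}`.
[cite: BrydgesSlade2015RGV, Lemma 1.5.1] -/
theorem blockProd_add_apply (F₁ F₂ : Λ → A) (X : Finset Λ) :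
    blockProd (fun B => F₁ B + F₂ B) X = ∑ Y ∈ X.powerset, blockProd F₁ Y * blockProd F₂ (X \ Y) := by
  have h : (fun B => F₁ B + F₂ B) = F₁ + F₂ := rfl
  rw [h, blockProd_add, mul_apply]

/-! ### Sums over subsets of a disjoint union; factorisation across two regions -/

/-- Subsets of a disjoint union `P₁ ⊔ P₂` correspond to pairs of subsets (`X ↦ (X ∩ P₁, X ∩ P₂)`),
so a sum over `𝒫(P₁ ∪ P₂)` is an iterated sum. [folklore] -/
theorem sum_powerset_union {M : Type*} [AddCommMonoid M] {P₁ P₂ : Finset Λ} (h : Disjoint P₁ P₂)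
    (f : Finset Λ → M) :
    ∑ X ∈ (P₁ ∪ P₂).powerset, f X = ∑ X₁ ∈ P₁.powerset, ∑ X₂ ∈ P₂.powerset, f (X₁ ∪ X₂) := by
  rw [← sum_product']
  refine sum_nbij' (fun X => (X ∩ P₁, X ∩ P₂)) (fun p => p.1 ∪ p.2) ?_ ?_ ?_ ?_ ?_
  · intro X _
    simp only [mem_product, mem_powerset]
    exact ⟨inter_subset_right, inter_subset_right⟩
  · rintro ⟨X₁, X₂⟩ hp
    simp only [mem_product, mem_powerset] at hp ⊢
    exact union_subset_union hp.1 hp.2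
  · intro X hX
    simp only [mem_powerset] at hX
    change X ∩ P₁ ∪ X ∩ P₂ = X
    rw [← inter_union_distrib_left, inter_eq_left.2 hX]
  · rintro ⟨X₁, X₂⟩ hp
    simp only [mem_product, mem_powerset] at hp
    have h1 : X₂ ∩ P₁ = ∅ := disjoint_iff_inter_eq_empty.1 (h.symm.mono_left hp.2)
    have h2 : X₁ ∩ P₂ = ∅ := disjoint_iff_inter_eq_empty.1 (h.mono_left hp.1)
    change ((X₁ ∪ X₂) ∩ P₁, (X₁ ∪ X₂) ∩ P₂) = (X₁, X₂)
    rw [union_inter_distrib_right, union_inter_distrib_right, h1, h2, union_empty, empty_union,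
      inter_eq_left.2 hp.1, inter_eq_left.2 hp.2]
  · intro X hX
    simp only [mem_powerset] at hX
    show f X = f (X ∩ P₁ ∪ X ∩ P₂)
    rw [← inter_union_distrib_left, inter_eq_left.2 hX]

/-- Set difference distributes over a disjoint union: for `X₁ ⊆ P₁`, `X₂ ⊆ P₂`, `P₁ ∩ P₂ = ∅`,
`(P₁ ∪ P₂) ∖ (X₁ ∪ X₂) = (P₁ ∖ X₁) ∪ (P₂ ∖ X₂)`. [folklore] -/
theorem union_sdiff_union_of_subset {P₁ P₂ X₁ X₂ : Finset Λ} (h : Disjoint P₁ P₂) (h₁ : X₁ ⊆ P₁)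
    (h₂ : X₂ ⊆ P₂) : (P₁ ∪ P₂) \ (X₁ ∪ X₂) = (P₁ \ X₁) ∪ (P₂ \ X₂) := by
  ext B
  simp only [mem_sdiff, mem_union]
  have hd : B ∈ P₁ → B ∉ P₂ := fun hB hB' => disjoint_left.1 h hB hB'
  have e₁ : B ∈ X₁ → B ∈ P₁ := fun hB => h₁ hB
  have e₂ : B ∈ X₂ → B ∈ P₂ := fun hB => h₂ hB
  tauto

/-- For `A₁ ⊆ U₁`, `A₂ ⊆ U₂` with `U₁, U₂` disjoint: `A₁ ∪ A₂ = U₁ ∪ U₂ ↔ A₁ = U₁ ∧ A₂ = U₂`.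
[folklore] -/
theorem union_eq_union_iff_of_subset {Λ' : Type*} [DecidableEq Λ'] {A₁ A₂ U₁ U₂ : Finset Λ'}
    (h : Disjoint U₁ U₂) (h₁ : A₁ ⊆ U₁) (h₂ : A₂ ⊆ U₂) :
    A₁ ∪ A₂ = U₁ ∪ U₂ ↔ A₁ = U₁ ∧ A₂ = U₂ := by
  constructor
  · intro he
    constructor
    · refine Subset.antisymm h₁ fun u hu => ?_
      have hu' : u ∈ A₁ ∪ A₂ := by rw [he]; exact mem_union_left _ hu
      rcases mem_union.1 hu' with h' | h'
      · exact h'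
      · exact absurd (h₂ h') (disjoint_left.1 h hu)
    · refine Subset.antisymm h₂ fun u hu => ?_
      have hu' : u ∈ A₁ ∪ A₂ := by rw [he]; exact mem_union_right _ hu
      rcases mem_union.1 hu' with h' | h'
      · exact absurd (h₁ h') (disjoint_right.1 h hu)
      · exact h'
  · rintro ⟨rfl, rfl⟩
    rfl

/-- **Factorised filtered sums over a disjoint union.** If a predicate `p` and a weight `f` on the
subsets of `P₁ ⊔ P₂` split as `p(X₁ ∪ X₂) ↔ p₁ X₁ ∧ p₂ X₂` and `f(X₁ ∪ X₂) = f₁ X₁ · f₂ X₂`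
(`Xᵢ ⊆ Pᵢ`), then `∑_{X ⊆ P₁∪P₂, p X} f X = (∑_{X₁ ⊆ P₁, p₁ X₁} f₁ X₁)(∑_{X₂ ⊆ P₂, p₂ X₂} f₂ X₂)`.
[folklore] -/
theorem sum_powerset_union_filter_eq_mul {P₁ P₂ : Finset Λ} (h : Disjoint P₁ P₂)
    (p : Finset Λ → Prop) [DecidablePred p] (p₁ p₂ : Finset Λ → Prop) [DecidablePred p₁]
    [DecidablePred p₂] (f f₁ f₂ : Finset Λ → A)
    (hp : ∀ X₁ ⊆ P₁, ∀ X₂ ⊆ P₂, (p (X₁ ∪ X₂) ↔ p₁ X₁ ∧ p₂ X₂))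
    (hf : ∀ X₁ ⊆ P₁, ∀ X₂ ⊆ P₂, p₁ X₁ → p₂ X₂ → f (X₁ ∪ X₂) = f₁ X₁ * f₂ X₂) :
    ∑ X ∈ (P₁ ∪ P₂).powerset.filter p, f X =
      (∑ X₁ ∈ P₁.powerset.filter p₁, f₁ X₁) * (∑ X₂ ∈ P₂.powerset.filter p₂, f₂ X₂) := by
  rw [sum_filter, sum_filter, sum_filter, sum_powerset_union h, sum_mul_sum]
  refine sum_congr rfl fun X₁ hX₁ => sum_congr rfl fun X₂ hX₂ => ?_
  have hX₁P : X₁ ⊆ P₁ := mem_powerset.1 hX₁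
  have hX₂P : X₂ ⊆ P₂ := mem_powerset.1 hX₂
  have hpp := hp X₁ hX₁P X₂ hX₂P
  by_cases h₁ : p₁ X₁
  · by_cases h₂ : p₂ X₂
    · rw [if_pos (hpp.2 ⟨h₁, h₂⟩), if_pos h₁, if_pos h₂, hf X₁ hX₁P X₂ hX₂P h₁ h₂]
    · rw [if_neg (fun hc => h₂ (hpp.1 hc).2), if_neg h₂, mul_zero]
  · rw [if_neg (fun hc => h₁ (hpp.1 hc).1), if_neg h₁, zero_mul]

/-- Block-factorised activities factorise across any pair of disjoint regions. [folklore] -/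
theorem blockProd_apply_union (F : Λ → A) {P₁ P₂ : Finset Λ} (h : Disjoint P₁ P₂) :
    ∀ X₁ ⊆ P₁, ∀ X₂ ⊆ P₂, blockProd F (X₁ ∪ X₂) = blockProd F X₁ * blockProd F X₂ :=
  fun _ h₁ _ h₂ => blockProd_union F (h.mono h₁ h₂)

/-- **The circle product preserves factorisation across two disjoint regions**: if `K` and `L`
both satisfy `K(X₁ ∪ X₂) = K(X₁)K(X₂)` whenever `X₁ ⊆ P₁`, `X₂ ⊆ P₂` (`P₁ ∩ P₂ = ∅`), then so does
`K ∘ L` (in applications: activities with the component factorisation property of Brydges–Slade V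
Def. 1.6.2, `P₁, P₂` unions of distinct components). [cite: BrydgesSlade2015RGV, Def. 1.6.2] -/
theorem mul_apply_union {K L : PolymerActivity Λ A} {P₁ P₂ : Finset Λ} (h : Disjoint P₁ P₂)
    (hK : ∀ X₁ ⊆ P₁, ∀ X₂ ⊆ P₂, K (X₁ ∪ X₂) = K X₁ * K X₂)
    (hL : ∀ X₁ ⊆ P₁, ∀ X₂ ⊆ P₂, L (X₁ ∪ X₂) = L X₁ * L X₂) :
    ∀ X₁ ⊆ P₁, ∀ X₂ ⊆ P₂, (K * L) (X₁ ∪ X₂) = (K * L) X₁ * (K * L) X₂ := by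
  intro X₁ hX₁ X₂ hX₂
  have hX : Disjoint X₁ X₂ := h.mono hX₁ hX₂
  rw [mul_apply, mul_apply, mul_apply, sum_powerset_union hX, sum_mul_sum]
  refine sum_congr rfl fun Y₁ hY₁ => sum_congr rfl fun Y₂ hY₂ => ?_
  have hY₁X : Y₁ ⊆ X₁ := mem_powerset.1 hY₁
  have hY₂X : Y₂ ⊆ X₂ := mem_powerset.1 hY₂
  rw [union_sdiff_union_of_subset hX hY₁X hY₂X, hK Y₁ (hY₁X.trans hX₁) Y₂ (hY₂X.trans hX₂),
    hL (X₁ \ Y₁) (sdiff_subset.trans hX₁) (X₂ \ Y₂) (sdiff_subset.trans hX₂), mul_mul_mul_comm]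

end BlockProd

/-! ### Refinement, closure, coarsening -/

section Reblocking

variable [Fintype Λ] {Λ' : Type*} [DecidableEq Λ']

/-! Declarations that do not need decidable equality on the fine blocks come first. -/

/-- The **refinement** `π⁻¹(U)` of a coarse polymer: the fine blocks whose coarse block lies in `U`
(for the blocks of a torus, `𝓑_j(U)` of Brydges–Slade). [cite: BrydgesSlade2015RGV, §1.3–§1.5] -/
def refinement (π : Λ → Λ') (U : Finset Λ') : Finset Λ := univ.filter fun B => π B ∈ U

/-- Membership in the refinement. [folklore] -/
@[simp] theorem mem_refinement {π : Λ → Λ'} {U : Finset Λ'} {B : Λ} : B ∈ refinement π U ↔ π B ∈ U := by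
  simp [refinement]

/-- Refinement is monotone. [folklore] -/
theorem refinement_mono (π : Λ → Λ') {U V : Finset Λ'} (h : U ⊆ V) : refinement π U ⊆ refinement π V :=
  fun _ hB => mem_refinement.2 (h (mem_refinement.1 hB))

/-- `π⁻¹(∅) = ∅`. [folklore] -/
@[simp] theorem refinement_empty (π : Λ → Λ') : refinement π (∅ : Finset Λ') = ∅ := by
  ext B; simp

/-- Disjoint coarse polymers have disjoint refinements. [folklore] -/
theorem disjoint_refinement (π : Λ → Λ') {U V : Finset Λ'} (h : Disjoint U V) :
    Disjoint (refinement π U) (refinement π V) := by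
  rw [disjoint_left] at h ⊢
  intro B hB hB'
  exact h (mem_refinement.1 hB) (mem_refinement.1 hB')

/-- The **closure** `X̄ = π(X)` is the smallest coarse polymer whose refinement contains `X`:
`π(X) ⊆ U ↔ X ⊆ π⁻¹(U)`. [cite: BrydgesSlade2015RGV, Def. 1.5.2] -/
theorem image_subset_iff_subset_refinement {π : Λ → Λ'} {X : Finset Λ} {U : Finset Λ'} :
    X.image π ⊆ U ↔ X ⊆ refinement π U := by
  rw [image_subset_iff]
  simp only [subset_iff, mem_refinement]

/-- A fine polymer with closure `U` lies in the refinement of `U`. [cite: BrydgesSlade2015RGV, Def. 1.5.2] -/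
theorem subset_refinement_of_image_eq {π : Λ → Λ'} {X : Finset Λ} {U : Finset Λ'} (h : X.image π = U) :
    X ⊆ refinement π U :=
  image_subset_iff_subset_refinement.1 h.le

/-- The closure of a subset of `π⁻¹(U)` is contained in `U`. [cite: BrydgesSlade2015RGV, Def. 1.5.2] -/
theorem image_subset_of_subset_refinement {π : Λ → Λ'} {X : Finset Λ} {U : Finset Λ'}
    (h : X ⊆ refinement π U) : X.image π ⊆ U :=
  image_subset_iff_subset_refinement.2 h

/-- The fine polymers with closure `U` are the same whether enumerated inside `π⁻¹(U)` or inside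
the refinement of any larger coarse polymer `V ⊇ U`. [cite: BrydgesSlade2015RGV, Def. 1.5.2] -/
theorem filter_powerset_refinement_image_eq {π : Λ → Λ'} {U V : Finset Λ'} (h : U ⊆ V) :
    ((refinement π V).powerset.filter fun X => X.image π = U) =
      ((refinement π U).powerset.filter fun X => X.image π = U) := by
  ext X
  simp only [mem_filter, mem_powerset]
  constructor
  · rintro ⟨-, hX⟩
    exact ⟨subset_refinement_of_image_eq hX, hX⟩
  · rintro ⟨hX, hXU⟩
    exact ⟨hX.trans (refinement_mono π h), hXU⟩

/-- The **coarsened block function** `F̃(B') = ∏_{π B = B'} F(B)`: the value on a coarse block of a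
fine block-factorised activity. [cite: BrydgesSlade2015RGV, Prop. 1.5.3] -/
def coarsen (π : Λ → Λ') (F : Λ → A) : Λ' → A := fun B' => ∏ B ∈ refinement π {B'}, F B

/-- Unfolding `coarsen`. [folklore] -/
theorem coarsen_apply (π : Λ → Λ') (F : Λ → A) (B' : Λ') :
    coarsen π F B' = ∏ B ∈ refinement π {B'}, F B := rfl

/-- A ring homomorphism passes through coarsening. [folklore] -/
theorem map_coarsen {A' : Type*} [CommRing A'] (f : A →+* A') (π : Λ → Λ') (F : Λ → A) :
    (fun B' => f (coarsen π F B')) = coarsen π (fun B => f (F B)) := by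
  funext B'
  simp only [coarsen_apply, map_prod]

/-- **Coarse block products are fine block products over the refinement**:
`F̃^W = F^{π⁻¹ W}`. [cite: BrydgesSlade2015RGV, Prop. 1.5.3] -/
theorem blockProd_coarsen (π : Λ → Λ') (F : Λ → A) (W : Finset Λ') :
    blockProd (coarsen π F) W = blockProd F (refinement π W) := by
  rw [blockProd_apply, blockProd_apply,
    ← prod_fiberwise_of_maps_to (s := refinement π W) (t := W) (g := π) (fun B hB => mem_refinement.1 hB)]
  refine prod_congr rfl fun B' hB' => ?_
  rw [coarsen_apply]
  refine prod_congr ?_ fun _ _ => rfl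
  ext B
  simp only [mem_filter, mem_refinement, mem_singleton]
  exact ⟨fun hB => ⟨by rw [hB]; exact hB', hB⟩, fun hB => hB.2⟩

/-! From here on the fine blocks carry decidable equality (unions, differences, circle products). -/

variable [DecidableEq Λ]

/-- `π⁻¹(U ∪ V) = π⁻¹U ∪ π⁻¹V`. [folklore] -/
theorem refinement_union (π : Λ → Λ') (U V : Finset Λ') :
    refinement π (U ∪ V) = refinement π U ∪ refinement π V := by
  ext B; simp [mem_union]

/-- `π⁻¹(V ∖ U) = π⁻¹V ∖ π⁻¹U`. [folklore] -/
theorem refinement_sdiff (π : Λ → Λ') (U V : Finset Λ') :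
    refinement π (V \ U) = refinement π V \ refinement π U := by
  ext B; simp [mem_sdiff]

/-! ### The reblocked activity and the reblocking identity -/

/-- **The reblocked activity** of a fine activity `K` against the block function `F`:

  `reblock π F K (U) = ∑_{X ⊆ π⁻¹U, X̄ = U} F^{π⁻¹U ∖ X} · K(X)`   (`U` a coarse polymer).

With `F = Ĩ` and `K ↦ δI^• ∘ θK` this is Brydges–Slade's `K⁽³⁾(U) = ∑_{X̄ = U} Ĩ^{U∖X}(δI ∘ θK)(X)`
before the fluctuation expectation (Prop. 5.1.1; Prop. 1.5.3 is the case `K = 𝟙_∅`).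
[cite: BrydgesSlade2015RGV, Prop. 5.1.1 eq. (5.5)] -/
def reblock (π : Λ → Λ') (F : Λ → A) (K : PolymerActivity Λ A) : PolymerActivity Λ' A :=
  fun U => ∑ X ∈ (refinement π U).powerset.filter (fun X => X.image π = U),
    blockProd F (refinement π U \ X) * K X

/-- Unfolding `reblock`. [cite: BrydgesSlade2015RGV, Prop. 5.1.1] -/
theorem reblock_apply (π : Λ → Λ') (F : Λ → A) (K : PolymerActivity Λ A) (U : Finset Λ') :
    reblock π F K U = ∑ X ∈ (refinement π U).powerset.filter (fun X => X.image π = U),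
      blockProd F (refinement π U \ X) * K X := rfl

/-- On the empty coarse polymer the reblocked activity is `K(∅)` (so it is normalised when `K` is).
[cite: BrydgesSlade2015RGV, Prop. 5.1.1] -/
theorem reblock_apply_empty (π : Λ → Λ') (F : Λ → A) (K : PolymerActivity Λ A) :
    reblock π F K ∅ = K ∅ := by
  rw [reblock_apply, refinement_empty, Finset.powerset_empty]
  rw [Finset.filter_singleton, if_pos (by simp), sum_singleton]
  simp

/-- **The reblocking identity** (the algebra of Brydges–Slade V, Prop. 1.5.3 / Prop. 5.1.1): for
every fine activity `K`, block function `F` and coarse polymer `V`,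

  `(reblock π F K ∘ F̃^•)(V) = (K ∘ F^•)(π⁻¹ V)`,   `F̃ = coarsen π F`,

i.e. `∑_{X ⊆ π⁻¹V} K(X) F^{π⁻¹V∖X} = ∑_{U ⊆ V} reblock(U) · F^{π⁻¹V ∖ π⁻¹U}`: group the fine polymers
`X` by their closure `U = X̄` and split `F^{π⁻¹V∖X} = F^{π⁻¹U∖X} F^{π⁻¹(V∖U)}`. With `V = Λ'` this is
the representation `Z = (K ∘ I^•)(Λ)` carried from scale `j` to scale `j+1`.
[cite: BrydgesSlade2015RGV, Prop. 5.1.1] -/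
theorem reblock_mul_blockProd_coarsen (π : Λ → Λ') (F : Λ → A) (K : PolymerActivity Λ A)
    (V : Finset Λ') :
    (reblock π F K * blockProd (coarsen π F)) V = (K * blockProd F) (refinement π V) := by
  rw [mul_apply, mul_apply]
  symm
  rw [← sum_fiberwise_of_maps_to (s := (refinement π V).powerset) (t := V.powerset)
    (g := fun X => X.image π) (fun X hX => mem_powerset.2 (image_subset_of_subset_refinement (mem_powerset.1 hX)))]
  refine sum_congr rfl fun U hU => ?_
  have hUV : U ⊆ V := mem_powerset.1 hU
  rw [reblock_apply, blockProd_coarsen, refinement_sdiff, sum_mul, filter_powerset_refinement_image_eq hUV]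
  refine sum_congr rfl fun X hX => ?_
  obtain ⟨hXU, -⟩ := mem_filter.1 hX
  have hXU' : X ⊆ refinement π U := mem_powerset.1 hXU
  have hsplit : refinement π V \ X = (refinement π U \ X) ∪ (refinement π V \ refinement π U) := by
    ext B
    simp only [mem_sdiff, mem_union]
    have e₁ : B ∈ X → B ∈ refinement π U := fun hB => hXU' hB
    have e₂ : B ∈ refinement π U → B ∈ refinement π V := fun hB => refinement_mono π hUV hB
    tauto
  have hdisj : Disjoint (refinement π U \ X) (refinement π V \ refinement π U) :=
    disjoint_sdiff.mono_left sdiff_subset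
  rw [hsplit, blockProd_union F hdisj]
  ring

/-- The reblocking identity in full volume: `(K ∘ F^•)(Λ) = (reblock π F K ∘ F̃^•)(Λ')`.
[cite: BrydgesSlade2015RGV, Prop. 5.1.1] -/
theorem reblock_mul_blockProd_coarsen_univ [Fintype Λ'] (π : Λ → Λ') (F : Λ → A) (K : PolymerActivity Λ A) :
    (reblock π F K * blockProd (coarsen π F)) univ = (K * blockProd F) univ := by
  have h : refinement π (univ : Finset Λ') = (univ : Finset Λ) := by
    ext B
    simp
  rw [reblock_mul_blockProd_coarsen, h]

/-! ### Component factorisation (algebraic level) -/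

/-- **Factorisation of the reblocked activity over disjoint coarse polymers.** If `K` factorises
across the refinements of the disjoint coarse polymers `U₁, U₂` (`K(X₁ ∪ X₂) = K(X₁)K(X₂)` for
`Xᵢ ⊆ π⁻¹Uᵢ` — e.g. `U₁, U₂` unions of distinct connected components and `K` with the component
factorisation property), then `reblock π F K (U₁ ∪ U₂) = reblock π F K (U₁) · reblock π F K (U₂)`:
a fine polymer `X ⊆ π⁻¹(U₁ ∪ U₂)` has closure `U₁ ∪ U₂` iff its two halves `X ∩ π⁻¹Uᵢ` have closures
`Uᵢ`. [cite: BrydgesSlade2015RGV, Prop. 5.1.1] -/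
theorem reblock_union (π : Λ → Λ') (F : Λ → A) {K : PolymerActivity Λ A} {U₁ U₂ : Finset Λ'}
    (hU : Disjoint U₁ U₂)
    (hK : ∀ X₁ ⊆ refinement π U₁, ∀ X₂ ⊆ refinement π U₂, K (X₁ ∪ X₂) = K X₁ * K X₂) :
    reblock π F K (U₁ ∪ U₂) = reblock π F K U₁ * reblock π F K U₂ := by
  have hP : Disjoint (refinement π U₁) (refinement π U₂) := disjoint_refinement π hU
  rw [reblock_apply, reblock_apply, reblock_apply, refinement_union]
  refine sum_powerset_union_filter_eq_mul hP (fun X => X.image π = U₁ ∪ U₂) (fun X => X.image π = U₁)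
    (fun X => X.image π = U₂) _ _ _ (fun X₁ hX₁ X₂ hX₂ => ?_) (fun X₁ hX₁ X₂ hX₂ _ _ => ?_)
  · rw [image_union]
    exact union_eq_union_iff_of_subset hU (image_subset_of_subset_refinement hX₁)
      (image_subset_of_subset_refinement hX₂)
  · rw [union_sdiff_union_of_subset hP hX₁ hX₂,
      blockProd_union F ((hP.mono sdiff_subset sdiff_subset)), hK X₁ hX₁ X₂ hX₂, mul_mul_mul_comm]

/-- **Locality of the reblocked activity**: `reblock π F K (U)` only involves `F` on `π⁻¹U` and `K` on
the fine polymers inside `π⁻¹U` ("field locality is straightforward").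
[cite: BrydgesSlade2015RGV, Prop. 5.1.1] -/
theorem reblock_congr (π : Λ → Λ') {F F' : Λ → A} {K K' : PolymerActivity Λ A} {U : Finset Λ'}
    (hF : ∀ B ∈ refinement π U, F B = F' B) (hK : ∀ X ⊆ refinement π U, K X = K' X) :
    reblock π F K U = reblock π F' K' U := by
  rw [reblock_apply, reblock_apply]
  refine sum_congr rfl fun X hX => ?_
  have hXU : X ⊆ refinement π U := mem_powerset.1 (mem_filter.1 hX).1
  rw [hK X hXU, blockProd_apply, blockProd_apply, prod_congr rfl fun B hB => hF B (mem_sdiff.1 hB).1]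

/-- **Component factorisation over a finite family.** If the coarse polymers `U i`, `i ∈ t`, are
pairwise disjoint, `K(∅) = 1`, and `K` factorises across `(π⁻¹(U i), π⁻¹(⋃_{j ∈ s} U j))` for every
`i ∈ t` and `s ⊆ t` not containing `i` (e.g. the `U i` are the connected components of their union
and `K` has the component factorisation property), then
`reblock π F K (⋃_{i ∈ t} U i) = ∏_{i ∈ t} reblock π F K (U i)`. [cite: BrydgesSlade2015RGV, Prop. 5.1.1] -/
theorem reblock_biUnion {ι : Type*} [DecidableEq ι] (π : Λ → Λ') (F : Λ → A) {K : PolymerActivity Λ A}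
    (hK0 : K ∅ = 1) (t : Finset ι) (U : ι → Finset Λ')
    (hdisj : ∀ i ∈ t, ∀ j ∈ t, i ≠ j → Disjoint (U i) (U j))
    (hK : ∀ i ∈ t, ∀ s ⊆ t, i ∉ s → ∀ X₁ ⊆ refinement π (U i), ∀ X₂ ⊆ refinement π (s.biUnion U),
      K (X₁ ∪ X₂) = K X₁ * K X₂) :
    reblock π F K (t.biUnion U) = ∏ i ∈ t, reblock π F K (U i) := by
  induction t using Finset.induction_on with
  | empty => rw [biUnion_empty, prod_empty, reblock_apply_empty, hK0]
  | @insert a t ha ih =>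
    rw [biUnion_insert, prod_insert ha]
    have hd : Disjoint (U a) (t.biUnion U) := by
      rw [disjoint_biUnion_right]
      intro j hj
      exact hdisj a (mem_insert_self a t) j (mem_insert_of_mem hj) (fun h => ha (h ▸ hj))
    rw [reblock_union π F hd (hK a (mem_insert_self a t) t (subset_insert a t) ha)]
    congr 1
    refine ih (fun i hi j hj hij => hdisj i (mem_insert_of_mem hi) j (mem_insert_of_mem hj) hij) ?_
    intro i hi s hs his
    exact hK i (mem_insert_of_mem hi) s (hs.trans (subset_insert a t)) his

/-! ### Termwise norm bound -/

/-- **Termwise norm bound for the reblocked activity**: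
`‖reblock π F K (U)‖ ≤ ∑_{X ⊆ π⁻¹U, X̄ = U} (∏_{B ∈ π⁻¹U∖X} ‖F B‖) ‖K X‖` ("the norm of a product is
less than the product of the norms"). [cite: BrydgesSlade2015RGV, §1.7] -/
theorem norm_reblock_le {𝕜 : Type*} [NormedCommRing 𝕜] [NormOneClass 𝕜] (π : Λ → Λ') (F : Λ → 𝕜)
    (K : PolymerActivity Λ 𝕜) (U : Finset Λ') :
    ‖reblock π F K U‖ ≤ ∑ X ∈ (refinement π U).powerset.filter (fun X => X.image π = U),
      (∏ B ∈ refinement π U \ X, ‖F B‖) * ‖K X‖ := by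
  rw [reblock_apply]
  refine (norm_sum_le _ _).trans (sum_le_sum fun X _ => ?_)
  refine (norm_mul_le _ _).trans ?_
  exact mul_le_mul_of_nonneg_right (Finset.norm_prod_le _ _) (norm_nonneg _)

/-- **Crude bound**: if `‖F B‖ ≤ t` on `π⁻¹U` then
`‖reblock π F K (U)‖ ≤ ∑_{X ⊆ π⁻¹U} t^{|π⁻¹U| − |X|} ‖K X‖` (drop the closure constraint).
[cite: BrydgesSlade2015RGV, §1.7] -/
theorem norm_reblock_le_of_norm_le {𝕜 : Type*} [NormedCommRing 𝕜] [NormOneClass 𝕜] (π : Λ → Λ')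
    {F : Λ → 𝕜} (K : PolymerActivity Λ 𝕜) (U : Finset Λ') {t : ℝ}
    (hF : ∀ B ∈ refinement π U, ‖F B‖ ≤ t) :
    ‖reblock π F K U‖ ≤ ∑ X ∈ (refinement π U).powerset,
      t ^ ((refinement π U).card - X.card) * ‖K X‖ := by
  refine (norm_reblock_le π F K U).trans ?_
  have hnn : ∀ X ∈ (refinement π U).powerset, 0 ≤ (∏ B ∈ refinement π U \ X, ‖F B‖) * ‖K X‖ :=
    fun X _ => mul_nonneg (prod_nonneg fun _ _ => norm_nonneg _) (norm_nonneg _)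
  refine (sum_le_sum_of_subset_of_nonneg (filter_subset _ _) fun X hX _ => hnn X hX).trans ?_
  refine sum_le_sum fun X hX => ?_
  have hXU : X ⊆ refinement π U := mem_powerset.1 hX
  refine mul_le_mul_of_nonneg_right ?_ (norm_nonneg _)
  rw [← card_sdiff_of_subset hXU, ← prod_const]
  exact prod_le_prod (fun _ _ => norm_nonneg _) fun B hB => hF B (mem_sdiff.1 hB).1

/-! ### After the fluctuation expectation: the single-step map on the non-perturbative coordinate -/

section Expectation

variable {S : Type*} [CommRing S] [Algebra S A]

/-- **The single renormalisation-group step on the non-perturbative coordinate.** Data: a blocking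
map `π`, the next-scale interaction `Ĩ : Λ → S` on fine blocks (a functional of the coarse field
only, i.e. valued in the coefficient ring `S`), the difference `δI = θI − Ĩ : Λ → A` and the shifted
activity `θK` (here simply `K`, valued in the `S`-algebra `A` of functionals of coarse and
fluctuation fields), and an `S`-linear map `E : A → S` integrating out the fluctuation field. Then

  `rgStep E π Ĩ δI K (U) = E( ∑_{X̄ = U} Ĩ^{π⁻¹U∖X} (δI^• ∘ K)(X) )` — Brydges–Slade's `K⁽³⁾(U)`.

[cite: BrydgesSlade2015RGV, Prop. 5.1.1 eq. (5.5)] -/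
def rgStep (E : A →ₗ[S] S) (π : Λ → Λ') (Inew : Λ → S) (δI : Λ → A) (K : PolymerActivity Λ A) :
    PolymerActivity Λ' S :=
  fun U => E (reblock π (fun B => algebraMap S A (Inew B)) (blockProd δI * K) U)

/-- Unfolding `rgStep`. [cite: BrydgesSlade2015RGV, Prop. 5.1.1] -/
theorem rgStep_apply (E : A →ₗ[S] S) (π : Λ → Λ') (Inew : Λ → S) (δI : Λ → A) (K : PolymerActivity Λ A)
    (U : Finset Λ') :
    rgStep E π Inew δI K U = E (reblock π (fun B => algebraMap S A (Inew B)) (blockProd δI * K) U) := rfl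

/-- Normalisation: if `K(∅) = 1` and `E 1 = 1` then `rgStep … (∅) = 1`.
[cite: BrydgesSlade2015RGV, Prop. 5.1.1] -/
theorem rgStep_apply_empty (E : A →ₗ[S] S) (π : Λ → Λ') (Inew : Λ → S) (δI : Λ → A)
    {K : PolymerActivity Λ A} (hK : K ∅ = 1) (hE : E 1 = 1) : rgStep E π Inew δI K ∅ = 1 := by
  rw [rgStep_apply, reblock_apply_empty, mul_apply_empty, blockProd_empty, hK, one_mul, hE]

/-- **The reblocking identity under the expectation** (Brydges–Slade V, Prop. 5.1.1, first part):
with `θI = Ĩ + δI` blockwise,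

  `E( (K ∘ (Ĩ + δI)^•)(π⁻¹V) ) = (rgStep E π Ĩ δI K ∘ Ĩ̃^•)(V)`,   `Ĩ̃ = coarsen π Ĩ`,

for every coarse polymer `V` (full volume: `V = Λ'`, `π⁻¹V = Λ`): "there is no `θ` operating on `Ĩ`,
and this factor contains no fluctuation fields upon which `E` can act" is the `S`-linearity of `E`.
[cite: BrydgesSlade2015RGV, Prop. 5.1.1] -/
theorem rgStep_spec (E : A →ₗ[S] S) (π : Λ → Λ') (Inew : Λ → S) (δI : Λ → A) (K : PolymerActivity Λ A)
    (V : Finset Λ') :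
    E ((K * blockProd (fun B => algebraMap S A (Inew B) + δI B)) (refinement π V)) =
      (rgStep E π Inew δI K * blockProd (coarsen π Inew)) V := by
  -- `(Ĩ + δI)^• = δI^• ∘ Ĩ^•` (binomial lemma), so `K ∘ (Ĩ+δI)^• = (δI^• ∘ K) ∘ Ĩ^•`
  have hbin : blockProd (fun B => algebraMap S A (Inew B) + δI B) =
      blockProd δI * blockProd (fun B => algebraMap S A (Inew B)) := by
    have h : (fun B => algebraMap S A (Inew B) + δI B) = (fun B => algebraMap S A (Inew B)) + δI := rfl
    rw [h, blockProd_add, mul_comm]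
  rw [hbin, ← mul_assoc, mul_comm K, ← reblock_mul_blockProd_coarsen, mul_apply, mul_apply, map_sum]
  refine sum_congr rfl fun U _ => ?_
  rw [rgStep_apply, ← map_coarsen (algebraMap S A), ← map_blockProd (algebraMap S A), mul_comm,
    ← Algebra.smul_def, LinearMap.map_smul, smul_eq_mul, mul_comm]

/-- **Component factorisation of the single-step map** (Brydges–Slade V, Prop. 5.1.1, second part:
"an immediate consequence of the factorisation properties for `K` and the finite-range property of
`E₊`"). Suppose `E` is multiplicative across two subalgebras `S₁, S₂` of `A` (independence of the
fluctuation field over two separated regions — the finite-range property), that `δI(B) ∈ Sᵢ` for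
`π B ∈ Uᵢ` and `K(X) ∈ Sᵢ` for `X ⊆ π⁻¹Uᵢ` (field locality), and that `K` factorises across
`(π⁻¹U₁, π⁻¹U₂)`, with `U₁, U₂` disjoint coarse polymers. Then
`rgStep (U₁ ∪ U₂) = rgStep (U₁) · rgStep (U₂)`. [cite: BrydgesSlade2015RGV, Prop. 5.1.1] -/
theorem rgStep_union (E : A →ₗ[S] S) (π : Λ → Λ') (Inew : Λ → S) {δI : Λ → A} {K : PolymerActivity Λ A}
    (S₁ S₂ : Subalgebra S A) (hE : ∀ x ∈ S₁, ∀ y ∈ S₂, E (x * y) = E x * E y)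
    {U₁ U₂ : Finset Λ'} (hU : Disjoint U₁ U₂)
    (hδ₁ : ∀ B, π B ∈ U₁ → δI B ∈ S₁) (hδ₂ : ∀ B, π B ∈ U₂ → δI B ∈ S₂)
    (hK₁ : ∀ X ⊆ refinement π U₁, K X ∈ S₁) (hK₂ : ∀ X ⊆ refinement π U₂, K X ∈ S₂)
    (hK : ∀ X₁ ⊆ refinement π U₁, ∀ X₂ ⊆ refinement π U₂, K (X₁ ∪ X₂) = K X₁ * K X₂) :
    rgStep E π Inew δI K (U₁ ∪ U₂) = rgStep E π Inew δI K U₁ * rgStep E π Inew δI K U₂ := by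
  have hP : Disjoint (refinement π U₁) (refinement π U₂) := disjoint_refinement π hU
  -- `δI^• ∘ K` factorises across the two refinements
  have hK' : ∀ X₁ ⊆ refinement π U₁, ∀ X₂ ⊆ refinement π U₂,
      (blockProd δI * K) (X₁ ∪ X₂) = (blockProd δI * K) X₁ * (blockProd δI * K) X₂ :=
    mul_apply_union hP (blockProd_apply_union δI hP) hK
  -- membership of the reblocked activities in `S₁`, `S₂`
  have hmem : ∀ (T : Subalgebra S A) (W : Finset Λ'), (∀ B, π B ∈ W → δI B ∈ T) →
      (∀ X ⊆ refinement π W, K X ∈ T) →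
      reblock π (fun B => algebraMap S A (Inew B)) (blockProd δI * K) W ∈ T := by
    intro T W hδ hKW
    rw [reblock_apply]
    refine Subalgebra.sum_mem T fun X hX => Subalgebra.mul_mem T ?_ ?_
    · exact Subalgebra.prod_mem T fun B _ => Subalgebra.algebraMap_mem T _
    · have hXW : X ⊆ refinement π W := mem_powerset.1 (mem_filter.1 hX).1
      rw [mul_apply]
      refine Subalgebra.sum_mem T fun Y hY => Subalgebra.mul_mem T ?_ ?_
      · have hYX : Y ⊆ X := mem_powerset.1 hY
        exact Subalgebra.prod_mem T fun B hB => hδ B (mem_refinement.1 (hXW (hYX hB)))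
      · exact hKW (X \ Y) (sdiff_subset.trans hXW)
  rw [rgStep_apply, rgStep_apply, rgStep_apply, reblock_union π _ hU hK']
  exact hE _ (hmem S₁ U₁ hδ₁ hK₁) _ (hmem S₂ U₂ hδ₂ hK₂)

end Expectation

/-! ### Expectations that are additive only on a domain (Bochner-type integrals) -/

section PartialExpectation

variable {S : Type*} [CommRing S] [Algebra S A]

/-- **The single-step map for a bare function `E : A → S`** — e.g. a fluctuation integral
`E F (φ) = ∫ F(φ, ζ) dμ(ζ)` defined on *all* functionals (junk value off the integrable ones) and
additive only on the `S`-submodule of integrable functionals: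
`rgMap E π Ĩ δI K (U) = E (reblock π Ĩ (δI^• ∘ K) U)`; `rgStep` is the case of an everywhere
`S`-linear `E` (`rgStep_eq_rgMap`). [cite: BrydgesSlade2015RGV, Prop. 5.1.1 eq. (5.5)] -/
def rgMap (E : A → S) (π : Λ → Λ') (Inew : Λ → S) (δI : Λ → A) (K : PolymerActivity Λ A) :
    PolymerActivity Λ' S :=
  fun U => E (reblock π (fun B => algebraMap S A (Inew B)) (blockProd δI * K) U)

/-- Unfolding `rgMap`. [cite: BrydgesSlade2015RGV, Prop. 5.1.1] -/
theorem rgMap_apply (E : A → S) (π : Λ → Λ') (Inew : Λ → S) (δI : Λ → A) (K : PolymerActivity Λ A)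
    (U : Finset Λ') :
    rgMap E π Inew δI K U = E (reblock π (fun B => algebraMap S A (Inew B)) (blockProd δI * K) U) := rfl

/-- `rgStep` is `rgMap` of the underlying function of a linear `E`. [folklore] -/
theorem rgStep_eq_rgMap (E : A →ₗ[S] S) (π : Λ → Λ') (Inew : Λ → S) (δI : Λ → A)
    (K : PolymerActivity Λ A) : rgStep E π Inew δI K = rgMap E π Inew δI K := rfl

/-- Normalisation: if `K(∅) = 1` and `E 1 = 1` then `rgMap … (∅) = 1`.
[cite: BrydgesSlade2015RGV, Prop. 5.1.1] -/
theorem rgMap_apply_empty (E : A → S) (π : Λ → Λ') (Inew : Λ → S) (δI : Λ → A)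
    {K : PolymerActivity Λ A} (hK : K ∅ = 1) (hE : E 1 = 1) : rgMap E π Inew δI K ∅ = 1 := by
  rw [rgMap_apply, reblock_apply_empty, mul_apply_empty, blockProd_empty, hK, one_mul, hE]

omit [Fintype Λ] [DecidableEq Λ'] [DecidableEq Λ] in
/-- A map that is additive on an `S`-submodule `D` and `S`-homogeneous on `D` is additive over
finite sums of elements of `D`. [folklore] -/
theorem map_finset_sum_of_mem {E : A → S} (D : Submodule S A)
    (hadd : ∀ x ∈ D, ∀ y ∈ D, E (x + y) = E x + E y) (hsmul : ∀ (c : S), ∀ x ∈ D, E (c • x) = c * E x)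
    {ι : Type*} (s : Finset ι) (x : ι → A) (hx : ∀ i ∈ s, x i ∈ D) :
    E (∑ i ∈ s, x i) = ∑ i ∈ s, E (x i) := by
  classical
  induction s using Finset.induction_on with
  | empty =>
    have h0 : E 0 = 0 := by simpa using hsmul 0 0 D.zero_mem
    rw [sum_empty, sum_empty, h0]
  | @insert a s ha ih =>
    have hxa : x a ∈ D := hx a (mem_insert_self a s)
    have hxs : ∀ i ∈ s, x i ∈ D := fun i hi => hx i (mem_insert_of_mem hi)
    rw [sum_insert ha, sum_insert ha, hadd _ hxa _ (D.sum_mem hxs), ih hxs]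

/-- **The reblocking identity under a partially additive expectation** (Brydges–Slade V,
Prop. 5.1.1, first part, in the form met by Bochner integrals): if `E : A → S` is additive and
`S`-homogeneous on an `S`-submodule `D ⊆ A` (the integrable functionals) and every reblocked
activity `reblock π Ĩ (δI^• ∘ K)(U)`, `U ⊆ V`, lies in `D`, then
`E((K ∘ (Ĩ + δI)^•)(π⁻¹V)) = (rgMap E π Ĩ δI K ∘ Ĩ̃^•)(V)`. [cite: BrydgesSlade2015RGV, Prop. 5.1.1] -/
theorem rgMap_spec (E : A → S) (D : Submodule S A)
    (hadd : ∀ x ∈ D, ∀ y ∈ D, E (x + y) = E x + E y) (hsmul : ∀ (c : S), ∀ x ∈ D, E (c • x) = c * E x)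
    (π : Λ → Λ') (Inew : Λ → S) (δI : Λ → A) (K : PolymerActivity Λ A) (V : Finset Λ')
    (hD : ∀ U ⊆ V, reblock π (fun B => algebraMap S A (Inew B)) (blockProd δI * K) U ∈ D) :
    E ((K * blockProd (fun B => algebraMap S A (Inew B) + δI B)) (refinement π V)) =
      (rgMap E π Inew δI K * blockProd (coarsen π Inew)) V := by
  have hbin : blockProd (fun B => algebraMap S A (Inew B) + δI B) =
      blockProd δI * blockProd (fun B => algebraMap S A (Inew B)) := by
    have h : (fun B => algebraMap S A (Inew B) + δI B) = (fun B => algebraMap S A (Inew B)) + δI := rfl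
    rw [h, blockProd_add, mul_comm]
  -- each summand is `Ĩ̃^{V∖U} • reblock(U) ∈ D`
  have hterm : ∀ U ∈ V.powerset,
      reblock π (fun B => algebraMap S A (Inew B)) (blockProd δI * K) U *
        blockProd (coarsen π (fun B => algebraMap S A (Inew B))) (V \ U) =
      blockProd (coarsen π Inew) (V \ U) • reblock π (fun B => algebraMap S A (Inew B)) (blockProd δI * K) U := by
    intro U _
    rw [← map_coarsen (algebraMap S A), ← map_blockProd (algebraMap S A), mul_comm, ← Algebra.smul_def]
  rw [hbin, ← mul_assoc, mul_comm K, ← reblock_mul_blockProd_coarsen, mul_apply, mul_apply,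
    sum_congr rfl hterm, map_finset_sum_of_mem D hadd hsmul _ _
      (fun U hU => D.smul_mem _ (hD U (mem_powerset.1 hU)))]
  refine sum_congr rfl fun U hU => ?_
  rw [rgMap_apply, hsmul _ _ (hD U (mem_powerset.1 hU)), mul_comm]

/-- **Component factorisation under a partially multiplicative expectation** (Brydges–Slade V,
Prop. 5.1.1, second part, in the form met by integrals over independent fields): as `rgStep_union`,
but `E : A → S` is only assumed multiplicative on pairs `x ∈ S₁ ∩ D`, `y ∈ S₂ ∩ D` (independent AND
integrable functionals), and the two reblocked activities are assumed to lie in `D`.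
[cite: BrydgesSlade2015RGV, Prop. 5.1.1] -/
theorem rgMap_union (E : A → S) (π : Λ → Λ') (Inew : Λ → S) {δI : Λ → A} {K : PolymerActivity Λ A}
    (S₁ S₂ : Subalgebra S A) (D : Set A)
    (hE : ∀ x ∈ S₁, ∀ y ∈ S₂, x ∈ D → y ∈ D → E (x * y) = E x * E y)
    {U₁ U₂ : Finset Λ'} (hU : Disjoint U₁ U₂)
    (hδ₁ : ∀ B, π B ∈ U₁ → δI B ∈ S₁) (hδ₂ : ∀ B, π B ∈ U₂ → δI B ∈ S₂)
    (hK₁ : ∀ X ⊆ refinement π U₁, K X ∈ S₁) (hK₂ : ∀ X ⊆ refinement π U₂, K X ∈ S₂)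
    (hK : ∀ X₁ ⊆ refinement π U₁, ∀ X₂ ⊆ refinement π U₂, K (X₁ ∪ X₂) = K X₁ * K X₂)
    (hD₁ : reblock π (fun B => algebraMap S A (Inew B)) (blockProd δI * K) U₁ ∈ D)
    (hD₂ : reblock π (fun B => algebraMap S A (Inew B)) (blockProd δI * K) U₂ ∈ D) :
    rgMap E π Inew δI K (U₁ ∪ U₂) = rgMap E π Inew δI K U₁ * rgMap E π Inew δI K U₂ := by
  have hP : Disjoint (refinement π U₁) (refinement π U₂) := disjoint_refinement π hU
  have hK' : ∀ X₁ ⊆ refinement π U₁, ∀ X₂ ⊆ refinement π U₂,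
      (blockProd δI * K) (X₁ ∪ X₂) = (blockProd δI * K) X₁ * (blockProd δI * K) X₂ :=
    mul_apply_union hP (blockProd_apply_union δI hP) hK
  have hmem : ∀ (T : Subalgebra S A) (W : Finset Λ'), (∀ B, π B ∈ W → δI B ∈ T) →
      (∀ X ⊆ refinement π W, K X ∈ T) →
      reblock π (fun B => algebraMap S A (Inew B)) (blockProd δI * K) W ∈ T := by
    intro T W hδ hKW
    rw [reblock_apply]
    refine Subalgebra.sum_mem T fun X hX => Subalgebra.mul_mem T ?_ ?_
    · exact Subalgebra.prod_mem T fun B _ => Subalgebra.algebraMap_mem T _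
    · have hXW : X ⊆ refinement π W := mem_powerset.1 (mem_filter.1 hX).1
      rw [mul_apply]
      refine Subalgebra.sum_mem T fun Y hY => Subalgebra.mul_mem T ?_ ?_
      · have hYX : Y ⊆ X := mem_powerset.1 hY
        exact Subalgebra.prod_mem T fun B hB => hδ B (mem_refinement.1 (hXW (hYX hB)))
      · exact hKW (X \ Y) (sdiff_subset.trans hXW)
  rw [rgMap_apply, rgMap_apply, rgMap_apply, reblock_union π _ hU hK']
  exact hE _ (hmem S₁ U₁ hδ₁ hK₁) _ (hmem S₂ U₂ hδ₂ hK₂) hD₁ hD₂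

end PartialExpectation

end Reblocking

end PolymerActivity

end Literature.MathematicalPhysics.QuantumFieldTheory

end
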